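import Summits.BirchSwinnertonDyer.Rank1Residual.X10.SecondDescentOneLineRankOne
import HarnessLib

/-!
# The PLANE door: `#Ш[p] ≤ p⁴` + one `p³`-subgroup of `Ш[p]` with NO non-zero class divisible by `p` + bsd.S18 ⇒ `#Ш(E/ℚ)(p) = p⁴` ⇒ `BSD(E,p)` at `ord_p #Ш_an = 4` — the door for the Ш-cells with `81 ∣ #Ш_an` and `dim_𝔽₃ Sel³ = 4` (cell `b2b-bsdres`, unit `b2b-bsdres-x10`, gen 57)

HONEST FRAMING (run/shared/lean/b2b/bsd-rank1-residual/, verbatim in every file): the goal of the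
cell is to DELETE the COMBINATION-SHAPED residual classes of the Birch–Swinnerton-Dyer formula for
ALL analytic-rank `≤ 1` elliptic curves over `ℚ` — "full BSD formula for every rank `≤ 1` curve in
class `C`" assembled STRICTLY from published theorems — so that the rank-`≤ 1` remainder becomes
exactly the CONSTRUCTION-SHAPED classes, which are TYPED (missing-input `Prop`s), NOT attempted.
This is not "finishing BSD". Theorems only (no definition, no new named fact); NOTHING IS BOOKED
here; no class label changes (X4 / X8 / X11a keep their marks and their class-level typed inputs).
Per pair.

**What this file is.** After route C9 / C9-RED and the rank-one door (`X10/SecondDescentOneLineRankOne`,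
p757852) the largest block of residue cells open at `3` on the book is the 54 RANK-ZERO cells with
`ord₃ #Ш_an = 4` ((3, X4) 46, (3, X8) 5, (3, X11a) 3; x10 gen 56/57 census). For those BSD predicts
`#Ш(E/ℚ)(3) = 81`, i.e. `Ш(3) ≅ (ℤ/3)⁴` or `(ℤ/9)²`. This file is the kernel door for the FIRST shape,
and nothing in it is new mathematics — it is the one-line door's algebra one level up:

* §1 (pure algebra, finite `A`, alternating non-degenerate bi-additive `B : A × A → ℚ/ℤ`): the radical
  `V = A[p] ∩ pA` of `B` on `A[p]` has EVEN codimension — `#A[p] = #V · p^{2j}` (tree lemma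
  `Literature.GroupTheory.FiniteAbelian.natCard_torsionBy_eq_mul_sq`: the orthogonal of `A[p]` is `pA`,
  and a complement of the radical carries a non-degenerate alternating `𝔽_p`-form). Hence if
  `#A[p] ≤ p⁴` and some subgroup `P ≤ A[p]` of order `p³` contains NO non-zero element of `pA`
  ("no non-zero class of the plane `ℙ(P) ⊂ ℙ(A[p])` is divisible by `p`"), then `V ∩ P = 0` gives
  `#V · p³ ≤ #A[p] = #V · p^{2j} ≤ p⁴`, so `j = 2`, `#A[p] = p⁴` and `V = 0`, i.e. `A[p²] = A[p]`
  (`sq_nsmul_stable_of_plane`, `natCard_torsionBy_eq_pow_four_of_plane`). Geometrically: a plane of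
  `ℙ³(𝔽_p)` meets every line (Bose–Burton), and `ℙ(V)` is empty, a line, or everything.
* §2 (any number field, `Ш` finite): `#Ш(E/K)(p) = p⁴` from bsd.S18 (`hCT`, DISPLAYED: Cassels 1962 =
  AEC X.4.14, tree named fact `WeierstrassCurve.exists_casselsTate_pairing`), `#Ш[p] ≤ p⁴` and the plane.
* §3 (over `ℚ`, analytic rank `≤ 1`, GZK): `bsdp_of_card_le_of_plane` and, through the PROVED descent
  count (`natCard_sha_torsionBy_le_of_card_selmerGroup_le`, AEC X.4.2(a)), `bsdp_of_card_selmerGroup_le_of_plane`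
  (`#Sel^(p) ≤ p^{r_an+4}`); Miller's clause (iv) is `ord_p #Ш_an = 4`.
* §4 the record shapes at `p = 3`: `bsdp_three_of_card_selmerThree_le_of_plane` (`r_an ≤ 1`) and the
  rank-zero literal form `bsdp_three_rankZero_of_card_selmerThree_of_plane (hCT) (hGZK) (W)
  (hr : r_an = 0) (hcard : #Sel³ = 81) (hP : ∃ P ≤ Ш, #P = 27 ∧ 3P = 0 ∧ no non-zero x ∈ P is 3z)
  (hq) (hv : ord₃ q = 4) : BSDp W 3`, plus the exact `3`-parts.

**The certificate a record would cite** (per curve; two engines per input as on every C9 record):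
(a) `dim_𝔽₃ Sel³(E/ℚ) = 4` (x11b `desc3lib.gp` ‖ x10b `desc3full_e2.py`); (b) three elements
`η_a, η_b, η_c` of the descent basis and the THIRTEEN plane cubics `C_η`, `η = η_a^i η_b^j η_c^k`
up to inverse, each with `Sel³(C_η/ℚ) = ∅` on both second-descent engines (Creutz 2014 Lemma 3.8,
Thm. 7.2, Alg. 7.3: `Sel³(C_η) = ∅` ⇔ no `D ∈ Ш` with `3D = [C_η]`). Non-divisibility of all 13
lines makes `η_a, η_b, η_c` independent in `Ш[3]` automatically (a relation would exhibit the
divisible class `0` on a line), so `P = ⟨[C_{η_a}], [C_{η_b}], [C_{η_c}]⟩` has order `27` with no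
torsion or Mordell–Weil datum. Whether a given cell has the `(ℤ/3)⁴` shape is decided by (a); the
`(ℤ/9)²` shape (`dim Sel³ = 2`) needs a `9`-covering / third descent and is NOT addressed here.
No pairing VALUE, no main conjecture, no image / reduction / torsion hypothesis.

References: Cassels 1962 (IV) [Cassels1962ArithmeticIV]; Cassels 1998 §1 [Cassels1998]; Silverman AEC
Thm. X.4.2(a), X.4.14 [SilvermanAEC2009]; B. Creutz, Math. Comp. 83 (2014) Lemma 3.8, Thm. 7.2, Alg. 7.3
[Creutz2014]; R. C. Bose – R. C. Burton 1966 (blocking subspaces) [folklore here: only the count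
`#V·#P ≤ #A[p]` is used]; R. L. Miller 2011 §1 and Def. 1.1 [Miller2011LMS]; companions
`X10/SecondDescentOneLineRankOne` (p757852), `X10/SecondDescentOneLineAnyTorsion` (p696472),
`X10/CasselsTatePairingCertificate` (p213922), `Literature/GroupTheory/FiniteAbelian/AlternatingPairing`;
cell file X10-AUDIT.md §63.
-/

set_option autoImplicit false

noncomputable section

open scoped Classical AddSubgroup

open WeierstrassCurve Literature.NumberTheory.EllipticCurves
  Literature.NumberTheory.EllipticCurves.Rank1Residual
  Literature.NumberTheory.EllipticCurves.Rank1Residual.Typed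
  Literature.NumberTheory.EllipticCurves.Rank1Residual.X11RankOneCertificates
  Literature.GroupTheory.FiniteAbelian
  Summit.BirchSwinnertonDyer.BirchSwinnertonDyer.Rank1Residual.IntModel
  Summit.BirchSwinnertonDyer.BirchSwinnertonDyer.Rank1Residual.X11RankOne
  Summit.BirchSwinnertonDyer.Rank1Residual.X11b

namespace Summit.BirchSwinnertonDyer.Rank1Residual.X10

/-! ### §1 Algebra: a `p³`-plane of non-divisible `p`-torsion classes under an alternating non-degenerate `ℚ/ℤ`-pairing -/

section Algebra

variable {A : Type*} [AddCommGroup A]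

/-- **The plane lemma, counting form.** Finite `A`, alternating non-degenerate bi-additive
`B : A × A → ℚ/ℤ`, `#A[p] ≤ p⁴`, and a subgroup `P` of order `p³` inside `A[p]` containing no
non-zero element of `pA`: then the radical `V = A[p] ∩ pA` is trivial AND `#A[p] = p⁴`. Proof:
`#A[p] = #V · p^{2j}` (`natCard_torsionBy_eq_mul_sq`), `V ∩ P = 0` so `(v, x) ↦ v + x` embeds
`V × P` into `A[p]`: `#V · p³ ≤ #V · p^{2j} ≤ p⁴` forces `j ≥ 2`, then `#V ≤ 1`.
[cite: Cassels1998, §1] [cite: SilvermanAEC2009, Thm. X.4.14] -/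
theorem torsionBy_inf_range_eq_bot_and_card_of_plane [Finite A] (B : A →+ A →+ AddCircle (1 : ℚ))
    (halt : ∀ x, B x x = 0) (hnd : ∀ x, (∀ y, B x y = 0) → x = 0) (p : ℕ) [hp : Fact p.Prime]
    (hub : Nat.card (AddSubgroup.torsionBy A p) ≤ p ^ 4)
    (P : AddSubgroup A) (hP : Nat.card P = p ^ 3) (hPt : P ≤ AddSubgroup.torsionBy A p)
    (hPnd : ∀ x ∈ P, x ≠ 0 → ∀ z : A, p • z ≠ x) :
    AddSubgroup.torsionBy A p ⊓ (nsmulAddMonoidHom (α := A) p).range = ⊥ ∧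
      Nat.card (AddSubgroup.torsionBy A p) = p ^ 4 := by
  obtain ⟨ι, hι⟩ := exists_circleTorsion_toZMod_injective p
  obtain ⟨j, hj⟩ := natCard_torsionBy_eq_mul_sq p B halt hnd ι hι
  set V : AddSubgroup A := AddSubgroup.torsionBy A p ⊓ (nsmulAddMonoidHom (α := A) p).range
    with hV
  have hp1 : 1 < p := hp.out.one_lt
  -- `V ∩ P = 0`
  have hVP : ∀ x, x ∈ V → x ∈ P → x = 0 := by
    intro x hxV hxP
    by_contra hx0
    obtain ⟨z, hz⟩ := (AddSubgroup.mem_inf.mp hxV).2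
    exact hPnd x hxP hx0 z (by simpa only [nsmulAddMonoidHom_apply] using hz)
  -- `(v, x) ↦ v + x : V × P → A[p]` is injective
  have hinj : Function.Injective
      (fun vx : V × P => (⟨(vx.1 : A) + (vx.2 : A), add_mem (AddSubgroup.mem_inf.mp vx.1.2).1
        (hPt vx.2.2)⟩ : AddSubgroup.torsionBy A p)) := by
    rintro ⟨v, x⟩ ⟨v', x'⟩ h
    have h' : (v : A) + (x : A) = (v' : A) + (x' : A) := congrArg Subtype.val h
    have hd : (v : A) - (v' : A) = (x' : A) - (x : A) := by
      rw [sub_eq_sub_iff_add_eq_add, h', add_comm]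
    have hmemV : (v : A) - (v' : A) ∈ V := sub_mem v.2 v'.2
    have hmemP : (v : A) - (v' : A) ∈ P := by rw [hd]; exact sub_mem x'.2 x.2
    have h0 : (v : A) - (v' : A) = 0 := hVP _ hmemV hmemP
    have hv : v = v' := Subtype.ext (sub_eq_zero.mp h0)
    have hx : x = x' := by
      rw [h0] at hd
      exact Subtype.ext (sub_eq_zero.mp hd.symm).symm
    rw [hv, hx]
  have hle : Nat.card V * p ^ 3 ≤ Nat.card (AddSubgroup.torsionBy A p) := by
    rw [← hP, ← Nat.card_prod]
    exact Nat.card_le_card_of_injective _ hinj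
  -- counting: `#V · p³ ≤ #V · p^{2j} ≤ p⁴`
  have hVpos : 0 < Nat.card V := Nat.card_pos
  have hj2 : 2 ≤ j := by
    by_contra h
    have hjle : 2 * j ≤ 2 := by omega
    have : Nat.card V * p ^ 3 ≤ Nat.card V * p ^ 2 :=
      hle.trans (by rw [hj]; exact Nat.mul_le_mul_left _ (Nat.pow_le_pow_right hp.out.pos hjle))
    have : p ^ 3 ≤ p ^ 2 := Nat.le_of_mul_le_mul_left this hVpos
    have : p ^ 2 < p ^ 3 := Nat.pow_lt_pow_right hp1 (by norm_num)
    omega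
  have h4 : p ^ 4 ≤ p ^ (2 * j) := Nat.pow_le_pow_right hp.out.pos (by omega)
  have hV1 : Nat.card V ≤ 1 := by
    have : Nat.card V * p ^ 4 ≤ 1 * p ^ 4 := by
      calc Nat.card V * p ^ 4 ≤ Nat.card V * p ^ (2 * j) := Nat.mul_le_mul_left _ h4
        _ = Nat.card (AddSubgroup.torsionBy A p) := hj.symm
        _ ≤ p ^ 4 := hub
        _ = 1 * p ^ 4 := (one_mul _).symm
    exact Nat.le_of_mul_le_mul_right this (pow_pos hp.out.pos 4)
  have hVcard : Nat.card V = 1 := le_antisymm hV1 hVpos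
  have hVbot : V = ⊥ := AddSubgroup.eq_bot_of_card_eq V hVcard
  refine ⟨hVbot, le_antisymm hub ?_⟩
  calc p ^ 4 ≤ p ^ (2 * j) := h4
    _ = 1 * p ^ (2 * j) := (one_mul _).symm
    _ = Nat.card (AddSubgroup.torsionBy A p) := by rw [← hVcard]; exact hj.symm

/-- **The plane lemma: `A[p²] = A[p]`.** Under the hypotheses of the counting form, no element of
`A[p]` is divisible by `p`, i.e. `∀ x, p² • x = 0 → p • x = 0`. [cite: Cassels1998, §1]
[cite: SilvermanAEC2009, Thm. X.4.14] -/
theorem sq_nsmul_stable_of_plane [Finite A] (B : A →+ A →+ AddCircle (1 : ℚ))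
    (halt : ∀ x, B x x = 0) (hnd : ∀ x, (∀ y, B x y = 0) → x = 0) (p : ℕ) [Fact p.Prime]
    (hub : Nat.card (AddSubgroup.torsionBy A p) ≤ p ^ 4)
    (P : AddSubgroup A) (hP : Nat.card P = p ^ 3) (hPt : P ≤ AddSubgroup.torsionBy A p)
    (hPnd : ∀ x ∈ P, x ≠ 0 → ∀ z : A, p • z ≠ x) :
    ∀ x : A, p ^ 2 • x = 0 → p • x = 0 :=
  shaNoPSqTorsion_iff_torsionBy_inf_range_eq_bot.mpr
    (torsionBy_inf_range_eq_bot_and_card_of_plane B halt hnd p hub P hP hPt hPnd).1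

/-- **The plane lemma: `#A[p] = p⁴` exactly** (the bound is attained). [cite: Cassels1998, §1] -/
theorem natCard_torsionBy_eq_pow_four_of_plane [Finite A] (B : A →+ A →+ AddCircle (1 : ℚ))
    (halt : ∀ x, B x x = 0) (hnd : ∀ x, (∀ y, B x y = 0) → x = 0) (p : ℕ) [Fact p.Prime]
    (hub : Nat.card (AddSubgroup.torsionBy A p) ≤ p ^ 4)
    (P : AddSubgroup A) (hP : Nat.card P = p ^ 3) (hPt : P ≤ AddSubgroup.torsionBy A p)
    (hPnd : ∀ x ∈ P, x ≠ 0 → ∀ z : A, p • z ≠ x) :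
    Nat.card (AddSubgroup.torsionBy A p) = p ^ 4 :=
  (torsionBy_inf_range_eq_bot_and_card_of_plane B halt hnd p hub P hP hPt hPnd).2

end Algebra

/-! ### §2 Any number field, `Ш` finite: `#Ш(E/K)(p) = p⁴` from bsd.S18 + `#Ш[p] ≤ p⁴` + the plane -/

section General

variable {K : Type*} [Field K] [NumberField K] (W : WeierstrassCurve K) [W.IsElliptic]

/-- **`#Ш(E/K)(p) = p⁴` EXACTLY from bsd.S18, `#Ш[p] ≤ p⁴` and a `p³`-subgroup of `Ш[p]` with no
non-zero class divisible by `p`** (`Ш` finite; any rank, any torsion): the displayed Cassels–Tate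
pairing is non-degenerate on a finite `Ш`; §1 gives `Ш[p²] = Ш[p]` and `#Ш[p] = p⁴`; so
`Ш(p) = Ш[p]` (`card_primaryComponent_eq_card_torsionBy_of_sq`) has order `p⁴`.
[cite: Cassels1962ArithmeticIV] [cite: Cassels1998, §1] [cite: SilvermanAEC2009, Thm. X.4.14] -/
theorem card_primaryComponent_sha_eq_pow_four_of_plane_of_card_le
    (hCT : exists_casselsTate_pairing (K := K)) [Finite W.sha] (p : ℕ) [Fact p.Prime]
    (hub : Nat.card (AddSubgroup.torsionBy W.sha p) ≤ p ^ 4)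
    (hP : ∃ P : AddSubgroup W.sha, Nat.card P = p ^ 3 ∧ (∀ x ∈ P, p • x = 0) ∧
      ∀ x ∈ P, x ≠ 0 → ∀ z : W.sha, p • z ≠ x) :
    Nat.card (AddCommGroup.primaryComponent W.sha p) = p ^ 4 := by
  obtain ⟨B, halt, hker⟩ := hCT W
  have hnd : ∀ x : W.sha, (∀ y, B x y = 0) → x = 0 := fun x hx => by
    have hmem : x ∈ AddSubgroup.divisibleElements W.sha := (hker x).mp hx
    rwa [divisibleElements_eq_bot_of_finite, AddSubgroup.mem_bot] at hmem
  obtain ⟨P, hPc, hPt, hPnd⟩ := hP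
  have hPt' : P ≤ AddSubgroup.torsionBy W.sha p := fun x hx =>
    AddSubgroup.torsionBy.nsmul_iff.mpr (hPt x hx)
  rw [card_primaryComponent_eq_card_torsionBy_of_sq
    (sq_nsmul_stable_of_plane B halt hnd p hub P hPc hPt' hPnd)]
  exact natCard_torsionBy_eq_pow_four_of_plane B halt hnd p hub P hPc hPt' hPnd

/-- The same from the descent COUNT `#Sel^(p)(E/K) ≤ p^{rank + 4}` (any torsion), by the PROVED exact
sequence count (`natCard_sha_torsionBy_le_of_card_selmerGroup_le`, AEC X.4.2(a)).
[cite: SilvermanAEC2009, Thm X.4.2(a) and Thm. X.4.14] [cite: Cassels1998, §1] -/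
theorem card_primaryComponent_sha_eq_pow_four_of_plane_of_card_selmerGroup_le
    (hCT : exists_casselsTate_pairing (K := K)) [Finite W.sha] (p : ℕ) [Fact p.Prime]
    (hcard : Nat.card (W.selmerGroup (p : ℤ)) ≤ p ^ (W.mordellWeilRank + 4))
    (hP : ∃ P : AddSubgroup W.sha, Nat.card P = p ^ 3 ∧ (∀ x ∈ P, p • x = 0) ∧
      ∀ x ∈ P, x ≠ 0 → ∀ z : W.sha, p • z ≠ x) :
    Nat.card (AddCommGroup.primaryComponent W.sha p) = p ^ 4 :=
  card_primaryComponent_sha_eq_pow_four_of_plane_of_card_le W hCT p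
    (natCard_sha_torsionBy_le_of_card_selmerGroup_le W p hcard) hP

end General

/-! ### §3 Over `ℚ`, analytic rank `≤ 1`: Miller's `BSD(E,p)` at `ord_p #Ш_an = 4` -/

section OverQ

variable (W : WeierstrassCurve ℚ) [W.IsElliptic] (p : ℕ) [Fact p.Prime]

/-- **`BSD(E,p)` in analytic rank `≤ 1` at a pair with `ord_p #Ш_an = 4` from bsd.S18, `#Ш[p] ≤ p⁴`
and a `p³`-plane of non-divisible classes of `Ш[p]`** (GZK `hGZK`: rank `= r_an`, `Ш` finite; §2;
Miller's clause (iv) = `ord_p q = 4`). Class-free, image-free, torsion-free; per curve.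
[cite: Miller2011LMS, §1 and Def. 1.1] [cite: Creutz2014, Lemma 3.8 and Thm. 7.2]
[cite: Cassels1962ArithmeticIV] [cite: SilvermanAEC2009, Thm. X.4.14] -/
theorem bsdp_of_card_le_of_plane
    (hCT : exists_casselsTate_pairing (K := ℚ)) (hGZK : rank_eq_analyticRank_of_analyticRank_le_one)
    (hr : W.analyticRank ≤ 1)
    (hub : Nat.card (AddSubgroup.torsionBy W.sha p) ≤ p ^ 4)
    (hP : ∃ P : AddSubgroup W.sha, Nat.card P = p ^ 3 ∧ (∀ x ∈ P, p • x = 0) ∧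
      ∀ x ∈ P, x ≠ 0 → ∀ z : W.sha, p • z ≠ x)
    {q : ℚ} (hq : shaAn W = (q : ℂ)) (hv : padicValRat p q = 4) : BSDp W p := by
  obtain ⟨hrank', hfin⟩ := hGZK W hr
  haveI : Finite W.sha := hfin
  refine ⟨hrank', Finite.of_injective _ Subtype.val_injective, q, hq, ?_⟩
  rw [card_primaryComponent_sha_eq_pow_four_of_plane_of_card_le W hCT p hub hP,
    padicValNat.prime_pow]
  exact_mod_cast hv

/-- **The exact `p`-part, no analytic value: `ord_p #Ш(E/ℚ) = 4`.** [cite: Cassels1962ArithmeticIV]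
[cite: Cassels1998, §1] -/
theorem padicValNat_shaOrder_eq_four_of_card_le_of_plane
    (hCT : exists_casselsTate_pairing (K := ℚ)) (hGZK : rank_eq_analyticRank_of_analyticRank_le_one)
    (hr : W.analyticRank ≤ 1)
    (hub : Nat.card (AddSubgroup.torsionBy W.sha p) ≤ p ^ 4)
    (hP : ∃ P : AddSubgroup W.sha, Nat.card P = p ^ 3 ∧ (∀ x ∈ P, p • x = 0) ∧
      ∀ x ∈ P, x ≠ 0 → ∀ z : W.sha, p • z ≠ x) :
    padicValNat p W.shaOrder = 4 := by
  haveI : Finite W.sha := (hGZK W hr).2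
  rw [WeierstrassCurve.shaOrder, ← padicValNat_card_addPrimaryComponent (A := W.sha) p,
    card_primaryComponent_sha_eq_pow_four_of_plane_of_card_le W hCT p hub hP, padicValNat.prime_pow]

/-- **`BSD(E,p)` from the descent COUNT `#Sel^(p)(E/ℚ) ≤ p^{r_an + 4}`, bsd.S18, the plane and
`ord_p #Ш_an = 4`** (GZK turns `r_an` into the rank; then the previous door). At rank `0`, `p = 3`
this is the certificate `dim Sel³ = 4` + THIRTEEN EMPTY second `3`-descents on the lines of one plane.
[cite: Miller2011LMS, §1 and Def. 1.1] [cite: Creutz2014, Lemma 3.8, Thm. 7.2 and Alg. 7.3]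
[cite: Cassels1962ArithmeticIV] [cite: SilvermanAEC2009, Thm X.4.2(a) and Thm. X.4.14] -/
theorem bsdp_of_card_selmerGroup_le_of_plane
    (hCT : exists_casselsTate_pairing (K := ℚ)) (hGZK : rank_eq_analyticRank_of_analyticRank_le_one)
    (hr : W.analyticRank ≤ 1)
    (hcard : Nat.card (W.selmerGroup (p : ℤ)) ≤ p ^ (W.analyticRank + 4))
    (hP : ∃ P : AddSubgroup W.sha, Nat.card P = p ^ 3 ∧ (∀ x ∈ P, p • x = 0) ∧
      ∀ x ∈ P, x ≠ 0 → ∀ z : W.sha, p • z ≠ x)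
    {q : ℚ} (hq : shaAn W = (q : ℂ)) (hv : padicValRat p q = 4) : BSDp W p := by
  have hrank : W.mordellWeilRank = W.analyticRank := (hGZK W hr).1
  exact bsdp_of_card_le_of_plane W p hCT hGZK hr
    (natCard_sha_torsionBy_le_of_card_selmerGroup_le W p (m := 4) (by rw [hrank]; exact hcard))
    hP hq hv

/-- **The exact `p`-part from the same data: `ord_p #Ш(E/ℚ) = 4`.** [cite: Cassels1962ArithmeticIV]
[cite: SilvermanAEC2009, Thm X.4.2(a)] -/
theorem padicValNat_shaOrder_eq_four_of_card_selmerGroup_le_of_plane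
    (hCT : exists_casselsTate_pairing (K := ℚ)) (hGZK : rank_eq_analyticRank_of_analyticRank_le_one)
    (hr : W.analyticRank ≤ 1)
    (hcard : Nat.card (W.selmerGroup (p : ℤ)) ≤ p ^ (W.analyticRank + 4))
    (hP : ∃ P : AddSubgroup W.sha, Nat.card P = p ^ 3 ∧ (∀ x ∈ P, p • x = 0) ∧
      ∀ x ∈ P, x ≠ 0 → ∀ z : W.sha, p • z ≠ x) :
    padicValNat p W.shaOrder = 4 := by
  have hrank : W.mordellWeilRank = W.analyticRank := (hGZK W hr).1
  exact padicValNat_shaOrder_eq_four_of_card_le_of_plane W p hCT hGZK hr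
    (natCard_sha_torsionBy_le_of_card_selmerGroup_le W p (m := 4) (by rw [hrank]; exact hcard)) hP

end OverQ

/-! ### §4 The record shapes at `p = 3` (image-free, reduction-type-free, torsion-agnostic) -/

/-- **Record shape, analytic rank `≤ 1`:** bsd.S18 (`hCT`), GZK, `r_an ≤ 1`, two-engine descent count
`#Sel³(E/ℚ) ≤ 3^{r_an+4}`, a `27`-subgroup of `Ш[3]` with no non-zero class divisible by `3`
(THIRTEEN two-engine EMPTY second `3`-descents on the lines of one plane of the descent basis,
Creutz 2014), `ord₃ #Ш_an = 4` ⇒ Miller's `BSD(E,3)`. Per pair; books nothing.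
[cite: Creutz2014, Lemma 3.8, Thm. 7.2 and Alg. 7.3] [cite: Cassels1962ArithmeticIV]
[cite: Miller2011LMS, Def. 1.1] [cite: SilvermanAEC2009, Thm X.4.2(a) and Thm. X.4.14] -/
theorem bsdp_three_of_card_selmerThree_le_of_plane
    (hCT : exists_casselsTate_pairing (K := ℚ)) (hGZK : rank_eq_analyticRank_of_analyticRank_le_one)
    (W : WeierstrassCurve ℚ) [W.IsElliptic] (hr : W.analyticRank ≤ 1)
    (hcard : Nat.card (W.selmerGroup (3 : ℤ)) ≤ 3 ^ (W.analyticRank + 4))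
    (hP : ∃ P : AddSubgroup W.sha, Nat.card P = 27 ∧ (∀ x ∈ P, 3 • x = 0) ∧
      ∀ x ∈ P, x ≠ 0 → ∀ z : W.sha, 3 • z ≠ x)
    {q : ℚ} (hq : shaAn W = (q : ℂ)) (hv : padicValRat 3 q = 4) : BSDp W 3 := by
  haveI : Fact (Nat.Prime 3) := ⟨by norm_num⟩
  exact bsdp_of_card_selmerGroup_le_of_plane W 3 hCT hGZK hr (by exact_mod_cast hcard)
    (by rw [show (3 : ℕ) ^ 3 = 27 by norm_num]; exact hP) hq hv

/-- **Record shape, RANK ZERO, literal count: `r_an = 0`, `#Sel³(E/ℚ) = 81` (`dim_𝔽₃ Sel³ = 4` on two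
engines), the plane of THIRTEEN EMPTY lines, `ord₃ #Ш_an = 4`, bsd.S18, GZK ⇒ `BSD(E,3)`.** The door
for the `(ℤ/3)⁴`-shaped cells among the book's rank-zero `81 ∣ #Ш_an` cells at `3`. Per pair; books
nothing; class marks untouched. [cite: Creutz2014, Lemma 3.8, Thm. 7.2 and Alg. 7.3]
[cite: Cassels1962ArithmeticIV] [cite: Miller2011LMS, Def. 1.1] [cite: SilvermanAEC2009, Thm X.4.2(a) and Thm. X.4.14] -/
theorem bsdp_three_rankZero_of_card_selmerThree_of_plane
    (hCT : exists_casselsTate_pairing (K := ℚ)) (hGZK : rank_eq_analyticRank_of_analyticRank_le_one)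
    (W : WeierstrassCurve ℚ) [W.IsElliptic] (hr : W.analyticRank = 0)
    (hcard : Nat.card (W.selmerGroup (3 : ℤ)) = 81)
    (hP : ∃ P : AddSubgroup W.sha, Nat.card P = 27 ∧ (∀ x ∈ P, 3 • x = 0) ∧
      ∀ x ∈ P, x ≠ 0 → ∀ z : W.sha, 3 • z ≠ x)
    {q : ℚ} (hq : shaAn W = (q : ℂ)) (hv : padicValRat 3 q = 4) : BSDp W 3 :=
  bsdp_three_of_card_selmerThree_le_of_plane hCT hGZK W (by rw [hr]; norm_num)
    (by rw [hr, hcard]; norm_num) hP hq hv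

/-- **The exact `3`-part, analytic rank `≤ 1` form: `ord₃ #Ш(E/ℚ) = 4`.** [cite: Cassels1962ArithmeticIV]
[cite: Creutz2014, Lemma 3.8] [cite: SilvermanAEC2009, Thm X.4.2(a)] -/
theorem padicValNat_shaOrder_three_eq_four_of_card_selmerThree_le_of_plane
    (hCT : exists_casselsTate_pairing (K := ℚ)) (hGZK : rank_eq_analyticRank_of_analyticRank_le_one)
    (W : WeierstrassCurve ℚ) [W.IsElliptic] (hr : W.analyticRank ≤ 1)
    (hcard : Nat.card (W.selmerGroup (3 : ℤ)) ≤ 3 ^ (W.analyticRank + 4))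
    (hP : ∃ P : AddSubgroup W.sha, Nat.card P = 27 ∧ (∀ x ∈ P, 3 • x = 0) ∧
      ∀ x ∈ P, x ≠ 0 → ∀ z : W.sha, 3 • z ≠ x) :
    padicValNat 3 W.shaOrder = 4 := by
  haveI : Fact (Nat.Prime 3) := ⟨by norm_num⟩
  exact padicValNat_shaOrder_eq_four_of_card_selmerGroup_le_of_plane W 3 hCT hGZK hr
    (by exact_mod_cast hcard) (by rw [show (3 : ℕ) ^ 3 = 27 by norm_num]; exact hP)

/-- **The exact `3`-part on a rank-zero pair with `#Sel³ = 81` and the plane: `ord₃ #Ш(E/ℚ) = 4`**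
(`#Ш(E/ℚ)[3^∞] = 81`), no analytic value used. [cite: Cassels1962ArithmeticIV] [cite: Creutz2014, Lemma 3.8]
[cite: SilvermanAEC2009, Thm X.4.2(a)] -/
theorem padicValNat_shaOrder_three_eq_four_rankZero_of_card_selmerThree_of_plane
    (hCT : exists_casselsTate_pairing (K := ℚ)) (hGZK : rank_eq_analyticRank_of_analyticRank_le_one)
    (W : WeierstrassCurve ℚ) [W.IsElliptic] (hr : W.analyticRank = 0)
    (hcard : Nat.card (W.selmerGroup (3 : ℤ)) = 81)
    (hP : ∃ P : AddSubgroup W.sha, Nat.card P = 27 ∧ (∀ x ∈ P, 3 • x = 0) ∧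
      ∀ x ∈ P, x ≠ 0 → ∀ z : W.sha, 3 • z ≠ x) :
    padicValNat 3 W.shaOrder = 4 :=
  padicValNat_shaOrder_three_eq_four_of_card_selmerThree_le_of_plane hCT hGZK W
    (by rw [hr]; norm_num) (by rw [hr, hcard]; norm_num) hP

end Summit.BirchSwinnertonDyer.Rank1Residual.X10

end
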